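import Summits.Ventures.PercRepro.C041TriDomGlueMainS

/-!
# ROW C-041 — GLUING AT A CUT VERTEX, VI: THE FIBRE COUNT FOR AN ARBITRARY PATTERN STATEMENT
(p6, gen 45; P6-TWOEXIT-LEAN.md §53 ADDENDUM 16)

The statement-agnostic form of THEOREM (CUT-VERTEX GLUING).  A PATTERN STATEMENT is an up-set inequality
`#{V ∧ S} ≤ #{V ∧ U}` between two classes of colourings.  Across a cut vertex `v` (marks on the near side, the
far side containing one mark `z`), such a class SPLITS along the `(v, z)`-type of the inside part
(`tDinS` / `tRinS` / `tBinS` / `tNinS`) into four classes of outside parts (`hS`, `hU` below — for the conjecture these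
are `cycCrossed_merge_iff` / `topBot_merge_iff`).  **THEOREM (GENERIC FIBRE COUNT)** (`count_le_of_fibresS`): if
the target has no `B`-fibre class, and the `D`-, `N`- and «`R` + `B`»-fibre inequalities hold on every fibre, the
statement holds on the host.  The `B`-fibres are transported into the `R`-fibres by the red-ward injection of
`exists_transportS` (THEOREM (TWO-MARK DOMINATION) on the far side + Hall), exactly as in `C041TriDomGlueMain`.

With it, every statement of the family `{CYC, SIB}` reduces across every cut vertex (`C041TriDomGlueSibling`): the
family is CLOSED under gluing, which is the content of the reduction of the conjecture to the 2-connected hosts.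
-/

namespace PercRepro

namespace ZoneZ

namespace MultiExit

open ZoneData Finset

variable {V₁ E₁ U₁ U₂ : Type} (Z₁ : ZoneData V₁ E₁ U₁ U₂) (st : E₁ → EStat) (z v : V₁)

variable [Fintype E₁] [DecidableEq E₁]

open Classical in
/-- A class that splits along the type of the inside part has the split fibre count. -/
theorem fibre_splitS (S SD SR SB SN : (E₁ → Bool) → Prop)
    (hS : ∀ o i, S (merge (InCS Z₁ st v z) o i) ↔ (tDinS Z₁ st z v i ∧ SD o) ∨ (tRinS Z₁ st z v i ∧ SR o) ∨
      (tBinS Z₁ st z v i ∧ SB o) ∨ (tNinS Z₁ st z v i ∧ SN o)) (V : (E₁ → Bool) → Prop) (i : E₁ → Bool) :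
    ((OutSupp (InCS Z₁ st v z)).filter fun o => V (merge (InCS Z₁ st v z) o i) ∧ S (merge (InCS Z₁ st v z) o i)).card =
      (if tDinS Z₁ st z v i then fibCS Z₁ st z v V SD i else 0) + (if tRinS Z₁ st z v i then fibCS Z₁ st z v V SR i else 0) +
        (if tBinS Z₁ st z v i then fibCS Z₁ st z v V SB i else 0) + (if tNinS Z₁ st z v i then fibCS Z₁ st z v V SN i else 0) := by
  rw [Finset.filter_congr fun o _ => and_congr_right fun _ => hS o i]
  unfold fibCS
  by_cases hR : RdS Z₁ (stInS Z₁ st v z) i v z <;> by_cases hB : MgS Z₁ (stInS Z₁ st v z) i v z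
  all_goals
    simp only [tDinS, tRinS, tBinS, tNinS, hR, hB, and_self, not_true_eq_false, not_false_eq_true, and_false,
      and_true, true_and, false_and, or_false, false_or, if_true, if_false, add_zero, zero_add]

open Classical in
/-- A class that splits along the type of the inside part, with no `B`-fibre class. -/
theorem fibre_splitS_noB (U UD UR UN : (E₁ → Bool) → Prop)
    (hU : ∀ o i, U (merge (InCS Z₁ st v z) o i) ↔ (tDinS Z₁ st z v i ∧ UD o) ∨ (tRinS Z₁ st z v i ∧ UR o) ∨
      (tNinS Z₁ st z v i ∧ UN o)) (V : (E₁ → Bool) → Prop) (i : E₁ → Bool) :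
    ((OutSupp (InCS Z₁ st v z)).filter fun o => V (merge (InCS Z₁ st v z) o i) ∧ U (merge (InCS Z₁ st v z) o i)).card =
      (if tDinS Z₁ st z v i then fibCS Z₁ st z v V UD i else 0) + (if tRinS Z₁ st z v i then fibCS Z₁ st z v V UR i else 0) +
        (if tNinS Z₁ st z v i then fibCS Z₁ st z v V UN i else 0) := by
  rw [Finset.filter_congr fun o _ => and_congr_right fun _ => hU o i]
  unfold fibCS
  by_cases hR : RdS Z₁ (stInS Z₁ st v z) i v z <;> by_cases hB : MgS Z₁ (stInS Z₁ st v z) i v z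
  all_goals
    simp only [tDinS, tRinS, tNinS, hR, hB, and_self, not_true_eq_false, not_false_eq_true, and_false,
      and_true, true_and, false_and, or_false, false_or, if_true, if_false, add_zero, zero_add]
  all_goals first
    | rfl
    | simp only [Finset.filter_false, Finset.card_empty]

open Classical in
/-- **THEOREM (GENERIC FIBRE COUNT)**: a pattern statement whose classes split along the cut, with no `B`-fibre
target, follows from its `D`-, `N`- and «`R` + `B`»-fibre inequalities on the near side. -/
theorem count_le_of_fibresS (S U SD SR SB SN UD UR UN : (E₁ → Bool) → Prop)
    (hS : ∀ o i, S (merge (InCS Z₁ st v z) o i) ↔ (tDinS Z₁ st z v i ∧ SD o) ∨ (tRinS Z₁ st z v i ∧ SR o) ∨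
      (tBinS Z₁ st z v i ∧ SB o) ∨ (tNinS Z₁ st z v i ∧ SN o))
    (hU : ∀ o i, U (merge (InCS Z₁ st v z) o i) ↔ (tDinS Z₁ st z v i ∧ UD o) ∨ (tRinS Z₁ st z v i ∧ UR o) ∨
      (tNinS Z₁ st z v i ∧ UN o))
    (hD : ∀ V : (E₁ → Bool) → Prop, UpSet V → ∀ i, fibCS Z₁ st z v V SD i ≤ fibCS Z₁ st z v V UD i)
    (hN : ∀ V : (E₁ → Bool) → Prop, UpSet V → ∀ i, fibCS Z₁ st z v V SN i ≤ fibCS Z₁ st z v V UN i)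
    (hRB : ∀ V : (E₁ → Bool) → Prop, UpSet V → ∀ i,
      fibCS Z₁ st z v V SR i + fibCS Z₁ st z v V SB i ≤ fibCS Z₁ st z v V UR i)
    (V : (E₁ → Bool) → Prop) (hV : UpSet V) :
    (univ.filter fun ω : E₁ → Bool => V ω ∧ S ω).card ≤ (univ.filter fun ω : E₁ → Bool => V ω ∧ U ω).card := by
  obtain ⟨φ, hinj, hφ⟩ := exists_transportS Z₁ st z v
  rw [card_filter_eq_sum_fibre (InCS Z₁ st v z), card_filter_eq_sum_fibre (InCS Z₁ st v z)]
  rw [Finset.sum_congr rfl fun i _ => fibre_splitS Z₁ st z v S SD SR SB SN hS V i,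
    Finset.sum_congr rfl fun i _ => fibre_splitS_noB Z₁ st z v U UD UR UN hU V i]
  rw [Finset.sum_add_distrib, Finset.sum_add_distrib, Finset.sum_add_distrib, Finset.sum_add_distrib,
    Finset.sum_add_distrib, ← Finset.sum_filter, ← Finset.sum_filter, ← Finset.sum_filter, ← Finset.sum_filter,
    ← Finset.sum_filter, ← Finset.sum_filter, ← Finset.sum_filter]
  have hD' : ∑ i ∈ (InSupp (InCS Z₁ st v z)).filter (tDinS Z₁ st z v), fibCS Z₁ st z v V SD i ≤
      ∑ i ∈ (InSupp (InCS Z₁ st v z)).filter (tDinS Z₁ st z v), fibCS Z₁ st z v V UD i :=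
    Finset.sum_le_sum fun i _ => hD V hV i
  have hN' : ∑ i ∈ (InSupp (InCS Z₁ st v z)).filter (tNinS Z₁ st z v), fibCS Z₁ st z v V SN i ≤
      ∑ i ∈ (InSupp (InCS Z₁ st v z)).filter (tNinS Z₁ st z v), fibCS Z₁ st z v V UN i :=
    Finset.sum_le_sum fun i _ => hN V hV i
  have hB : ∑ i ∈ InBS Z₁ st z v, fibCS Z₁ st z v V SB i ≤ ∑ i ∈ InRS Z₁ st z v, fibCS Z₁ st z v V SB i := by
    calc ∑ i ∈ InBS Z₁ st z v, fibCS Z₁ st z v V SB i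
        ≤ ∑ i ∈ InBS Z₁ st z v, fibCS Z₁ st z v V SB (φ i) :=
          Finset.sum_le_sum fun i hi => fibS_mono Z₁ st z v hV _ (hφ i hi).2
      _ = ∑ j ∈ (InBS Z₁ st z v).image φ, fibCS Z₁ st z v V SB j := by
          rw [Finset.sum_image fun i hi i' hi' h => hinj (Finset.mem_coe.mpr hi) (Finset.mem_coe.mpr hi') h]
      _ ≤ ∑ j ∈ InRS Z₁ st z v, fibCS Z₁ st z v V SB j := by
          apply Finset.sum_le_sum_of_subset
          intro j hj
          obtain ⟨i, hi, rfl⟩ := Finset.mem_image.mp hj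
          exact (hφ i hi).1
  have hR : ∑ i ∈ InRS Z₁ st z v, fibCS Z₁ st z v V SR i + ∑ i ∈ InRS Z₁ st z v, fibCS Z₁ st z v V SB i ≤
      ∑ i ∈ InRS Z₁ st z v, fibCS Z₁ st z v V UR i := by
    rw [← Finset.sum_add_distrib]
    exact Finset.sum_le_sum fun i _ => hRB V hV i
  calc ∑ i ∈ (InSupp (InCS Z₁ st v z)).filter (tDinS Z₁ st z v), fibCS Z₁ st z v V SD i +
        ∑ i ∈ (InSupp (InCS Z₁ st v z)).filter (tRinS Z₁ st z v), fibCS Z₁ st z v V SR i +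
        ∑ i ∈ (InSupp (InCS Z₁ st v z)).filter (tBinS Z₁ st z v), fibCS Z₁ st z v V SB i +
        ∑ i ∈ (InSupp (InCS Z₁ st v z)).filter (tNinS Z₁ st z v), fibCS Z₁ st z v V SN i
      ≤ ∑ i ∈ (InSupp (InCS Z₁ st v z)).filter (tDinS Z₁ st z v), fibCS Z₁ st z v V UD i +
        ∑ i ∈ InRS Z₁ st z v, fibCS Z₁ st z v V SR i +
        ∑ i ∈ InRS Z₁ st z v, fibCS Z₁ st z v V SB i +
        ∑ i ∈ (InSupp (InCS Z₁ st v z)).filter (tNinS Z₁ st z v), fibCS Z₁ st z v V UN i :=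
        add_le_add (add_le_add (add_le_add hD' le_rfl) hB) hN'
    _ = ∑ i ∈ (InSupp (InCS Z₁ st v z)).filter (tDinS Z₁ st z v), fibCS Z₁ st z v V UD i +
        (∑ i ∈ InRS Z₁ st z v, fibCS Z₁ st z v V SR i + ∑ i ∈ InRS Z₁ st z v, fibCS Z₁ st z v V SB i) +
        ∑ i ∈ (InSupp (InCS Z₁ st v z)).filter (tNinS Z₁ st z v), fibCS Z₁ st z v V UN i := by ring
    _ ≤ ∑ i ∈ (InSupp (InCS Z₁ st v z)).filter (tDinS Z₁ st z v), fibCS Z₁ st z v V UD i +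
        ∑ i ∈ (InSupp (InCS Z₁ st v z)).filter (tRinS Z₁ st z v), fibCS Z₁ st z v V UR i +
        ∑ i ∈ (InSupp (InCS Z₁ st v z)).filter (tNinS Z₁ st z v), fibCS Z₁ st z v V UN i :=
        add_le_add (add_le_add le_rfl hR) le_rfl

open Classical in
/-- A fibre inequality from an up-set statement on `stOut` whose classes depend only on the outside part. -/
theorem fibS_le_of_stOutS (P Q : (E₁ → Bool) → Prop)
    (hP : ∀ o i, P (merge (InCS Z₁ st v z) o i) ↔ P o) (hQ : ∀ o i, Q (merge (InCS Z₁ st v z) o i) ↔ Q o)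
    (h : ∀ V : (E₁ → Bool) → Prop, UpSet V →
      (univ.filter fun ω : E₁ → Bool => V ω ∧ P ω).card ≤ (univ.filter fun ω : E₁ → Bool => V ω ∧ Q ω).card)
    {V : (E₁ → Bool) → Prop} (hV : UpSet V) (i : E₁ → Bool) : fibCS Z₁ st z v V P i ≤ fibCS Z₁ st z v V Q i := by
  have h' := h (fun ω => V (merge (InCS Z₁ st v z) ω i)) (upSet_fibreOut _ hV i)
  rw [card_outOnly_eq_fibS Z₁ st z v P hP, card_outOnly_eq_fibS Z₁ st z v Q hQ] at h'
  exact Nat.le_of_mul_le_mul_left h' (card_InSupp_pos _)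

/-- The empty class splits trivially. -/
theorem fibCS_false_le (V : (E₁ → Bool) → Prop) (Q : (E₁ → Bool) → Prop) (i : E₁ → Bool) :
    fibCS Z₁ st z v V (fun _ => False) i ≤ fibCS Z₁ st z v V Q i := by
  unfold fibCS
  simp only [and_false, Finset.filter_false, Finset.card_empty]
  exact Nat.zero_le _

end MultiExit

end ZoneZ

end PercRepro
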